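import Summits.QuantumFields.YangMills.Theorems.VirialFluxGapCentralLiftProximity
import HarnessLib

/-!
# Route `VirialFluxGap` (YangMills): CENTRAL COERCIVITY of the periodic deficit in polynomial (non-sharp) form — proximity to the central
# projection `π_C P` with exponent ONE and the polynomial cost of `π_C` (central chart C1, part II-b; free-hands helper toward crux ⟨stmt-QuantumFields-24141⟩)

Width seat `ym-line-sfw-p2-w3` g59 (cell ym-idea-1, free hands; own crux ⟨22884⟩ has no free stub), `--supports stmt-QuantumFields-24141`.

Part I (✓`…VirialFluxGapCombShadow`) puts every ring history `P` with slice `0` in comb gauge within `16L²·√F₀(P)` per variable of its comb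
shadow `K(P) = ((fun _ => combFlat (wrapReps (P.1 0))), fun _ => P.2 0)` and bounds the shadow's deficit by `2832·L⁶·F₀(P)`.  The central chart
of the ⟨24141⟩ Euler field is written at the CENTRAL PROJECTION `π_C P = centralProj L σ σ₄ P` (✓`FrameDerivative.centralProj`: the
comb-constant history whose representatives are the central lifts `(σ_B√(1 − |z_B|²), z_B)` of the wrap-block ∕ seam AVERAGES `z_B` of the imaginary
parts).  On the central region — signs `σ_k, σ₄ ∈ {±1}` with the shadow data on the corresponding hemispheres, `σ_k·Re q(w_k) ≥ ½`,
`σ₄·Re q(P.2 0) ≥ ½` — this file transfers both halves of part I from `K(P)` to `π_C P` (§3 = transverse, §4 = zero modes):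

* (part II-a, ✓`…VirialFluxGapCentralLiftProximity`: the central lift is `√17`-Lipschitz on a hemisphere; `‖q(w_k) − lift σ_k z_k‖² ≤ 17·(16L²δ)²`,
  `‖q(P.2 0) − lift σ₄ z₄‖² ≤ 17·(12L²δ)²`, `δ = √F₀(P)`);
* §3 ★★★ `norm_sq_slice_sub_centralProj_le` ∕ `norm_sq_seam_sub_centralProj_le` — PER VARIABLE `‖q(P.1 i e) − q((π_C P).1 i e)‖² ≤ 9216·L⁴·F₀(P)`,
  `‖q(P.2 x) − q((π_C P).2 x)‖² ≤ 5184·L⁴·F₀(P)`; ★★★ `sum_norm_sq_sub_centralProj_le` — `Σ_variables ‖q(P_v) − q((π_C P)_v)‖² ≤ 60480·L⁸·F₀(P)`: the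
  TRANSVERSE half of the central coercivity, `‖P − π_C P‖² ≲ L⁸·F₀(P)`, exponent ONE, no additive `ρ`;
* §4 ★★★ `ringDeficit_centralProj_le_mul` — `F₀(π_C P) ≤ 880000·L⁶·F₀(P)`: the ZERO-MODE half; with ✓`ringDeficit_centralProj` (the explicit quartic
  `Q(z) = 2L²Σ_{k<l}4|z_k × z_l|² + L²Σ_k 4|z_k × z₄|²` of the block averages) this reads `Q(z(P)) ≲ L⁶·F₀(P)`, and with ✓`frameD_sq_le_two_mul_ringDeficit`
  at `π_C P` it bounds the subtracted gradient `∇F₀∘π_C` of LEAD note №4 by `poly(L)·F₀(P)`.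

WHY THE NON-SHARP FORM SUFFICES (design remark, w3 g59 on the ym-idea-1 bus, for the LEAD ∕ assembler to referee): with weights `(z : ¼, u : ½)` the
central field `X_c = X_z + Π_⊥A⁻¹Π_⊥(∇F − ∇F∘π_C)` reproduces the weight-one model `Q(z) + g(z)·u + ½uᵀH(z)u` exactly, and every defect has weight
`≥ 5/4`; so `F₀ ≥ poly(L)⁻¹·(‖u‖² + Q(z))` with polynomial handover radii closes the drive inequality (E1) without the exact completed square.

HONEST LABEL: classical lattice ∕ quaternion inequalities (zero ℏ), helpers for a RECORD-label crux of a DRAFT route; the Euler field is NOT assembled;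
⟨24141⟩ and ⟨22884⟩ stay OPEN; no stub ∕ crux ∕ rung ∕ summit is closed; the Yang–Mills mass gap is NOT proved by this; no summit is proved by a line.
THEOREMS ONLY (no `def`, no `sorry`).

References: M. Lüscher, Nucl. Phys. B 219 (1983) 233–261, §2 [Luscher1983]; A. Coste, A. González-Arroyo, J. Jurkiewicz, C. P. Korthals Altes,
Nucl. Phys. B 262 (1985) 67–94 [CosteEtAl1985]; E. Seiler, LNP 159 (1982), §2 [SeilerLNP1982].
-/

set_option autoImplicit false

noncomputable section

open scoped Quaternion Matrix BigOperators
open Literature.MathematicalPhysics.QuantumFieldTheory hiding SU2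
open Literature.MathematicalPhysics.QuantumLattice

namespace Summit.QuantumFields.YangMills.Theorems.VirialFluxGap.CentralCoercivity

open Summit.QuantumFields.YangMills.Theorems.FemtoTransferGap
open Summit.QuantumFields.YangMills.Theorems.FemtoTransferGap.TT
open Summit.QuantumFields.YangMills.Theorems.FemtoTransferGap.TwoLattice
open Summit.QuantumFields.YangMills.Theorems.FemtoTransferGap.TwoLattice.Flat
open Summit.QuantumFields.YangMills.Theorems.FemtoTransferGap.TwoLattice.Cov
open Summit.QuantumFields.YangMills.Theorems.VirialFluxGap.RingDeficit
open Summit.QuantumFields.YangMills.Theorems.VirialFluxGap.CombConstant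
open Summit.QuantumFields.YangMills.Theorems.VirialFluxGap.FrameDerivative
open Summit.QuantumFields.YangMills.Theorems.ToronValleyVolume.Lojasiewicz

variable {L : ℕ} [NeZero L]

/-! ## §3 Per-variable and total proximity to `π_C P` -/

/-- ★★★ **Slices versus the central projection, per link**: on the central region (slice `0` in comb gauge, `σ_k·Re q(w_k) ≥ ½`),
`‖q(P.1 i e) − q((π_C P).1 i e)‖² ≤ 9216·L⁴·F₀(P)` for every slice `i` and link `e` (wrap links: shadow `16L²δ` plus lift `√17·16L²δ`; other links:
both sides are compared with `1`). [cite: CosteEtAl1985] -/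
theorem norm_sq_slice_sub_centralProj_le (P : (Fin (2 * L - 1 + 1) → GaugeConfig 3 L SU2) × (Site 3 L → SU2))
    (ht : treeGauge (P.1 0) = 1) {σ : Fin 3 → ℝ} (hσ : ∀ k, σ k = 1 ∨ σ k = -1) (σ₄ : ℝ)
    (hW : ∀ k : Fin 3, (1 / 2 : ℝ) ≤ σ k * (su2Quat (wrapReps (P.1 0) k)).re)
    (i : Fin (2 * L - 1 + 1)) (e : Edge 3 L) :
    ‖su2Quat (P.1 i e) - su2Quat ((centralProj L σ σ₄ P).1 i e)‖ ^ 2 ≤ 9216 * (L : ℝ) ^ 4 * ringDeficit L (fun _ => false) P := by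
  set F := ringDeficit L (fun _ => false) P with hF
  set δ := Real.sqrt F with hδ
  have hF0 : 0 ≤ F := ringDeficit_nonneg _ P
  have hδ2 : δ ^ 2 = F := Real.sq_sqrt hF0
  have hδ0 : 0 ≤ δ := Real.sqrt_nonneg _
  have hL1 : (1 : ℝ) ≤ L := by exact_mod_cast NeZero.one_le
  have hL0 : (0 : ℝ) ≤ L := by linarith
  have h2ab : ∀ a b : ℝ, (a + b) ^ 2 ≤ 2 * a ^ 2 + 2 * b ^ 2 := fun a b => by nlinarith [sq_nonneg (a - b)]
  have hshadow : fd (P.1 i e) (combFlat (wrapReps (P.1 0)) e) ≤ 16 * (L : ℝ) ^ 2 * δ :=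
    (fd_slice_combShadow_le P ht i e).trans (mul_le_mul_of_nonneg_right (four_add_twelve_sq_le hL1) hδ0)
  have hq1 : ‖su2Quat (P.1 i e) - su2Quat (combFlat (wrapReps (P.1 0)) e)‖ ≤ 16 * (L : ℝ) ^ 2 * δ :=
    (norm_su2Quat_sub_le_fd _ _).trans hshadow
  show ‖su2Quat (P.1 i e) - su2Quat (combFlat (fun k => centralRep (σ k) (blockIm L (wrapBlock L k) k P)) e)‖ ^ 2 ≤
    9216 * (L : ℝ) ^ 4 * F
  rw [combFlat_apply]
  rw [combFlat_apply] at hq1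
  by_cases hx : e.1 e.2 = -1
  · rw [if_pos hx]
    rw [if_pos hx] at hq1
    have hz := normSq_blockIm_le_one (wrapBlock L e.2) e.2 P
    rw [su2Quat_centralRep (sq_eq_one_of_sign (hσ e.2)) hz]
    have hb := norm_sq_wrapRep_sub_lift_blockIm_le P ht (hσ e.2) e.2 (hW e.2)
    have ha : ‖su2Quat (P.1 i e) - su2Quat (wrapReps (P.1 0) e.2)‖ ^ 2 ≤ (16 * (L : ℝ) ^ 2 * δ) ^ 2 :=
      pow_le_pow_left₀ (norm_nonneg _) hq1 2
    have htri := norm_sub_le_norm_sub_add_norm_sub (su2Quat (P.1 i e)) (su2Quat (wrapReps (P.1 0) e.2))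
      (liftQuat (σ e.2) (blockIm L (wrapBlock L e.2) e.2 P))
    calc ‖su2Quat (P.1 i e) - liftQuat (σ e.2) (blockIm L (wrapBlock L e.2) e.2 P)‖ ^ 2
        ≤ (‖su2Quat (P.1 i e) - su2Quat (wrapReps (P.1 0) e.2)‖ +
            ‖su2Quat (wrapReps (P.1 0) e.2) - liftQuat (σ e.2) (blockIm L (wrapBlock L e.2) e.2 P)‖) ^ 2 :=
          pow_le_pow_left₀ (norm_nonneg _) htri 2
      _ ≤ 2 * ‖su2Quat (P.1 i e) - su2Quat (wrapReps (P.1 0) e.2)‖ ^ 2 +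
            2 * ‖su2Quat (wrapReps (P.1 0) e.2) - liftQuat (σ e.2) (blockIm L (wrapBlock L e.2) e.2 P)‖ ^ 2 := h2ab _ _
      _ ≤ 2 * (16 * (L : ℝ) ^ 2 * δ) ^ 2 + 2 * (17 * (16 * (L : ℝ) ^ 2 * δ) ^ 2) := by linarith
      _ = 9216 * (L : ℝ) ^ 4 * δ ^ 2 := by ring
      _ = 9216 * (L : ℝ) ^ 4 * F := by rw [hδ2]
  · rw [if_neg hx]
    rw [if_neg hx] at hq1
    calc ‖su2Quat (P.1 i e) - su2Quat 1‖ ^ 2 ≤ (16 * (L : ℝ) ^ 2 * δ) ^ 2 := pow_le_pow_left₀ (norm_nonneg _) hq1 2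
      _ = 256 * (L : ℝ) ^ 4 * F := by rw [← hδ2]; ring
      _ ≤ 9216 * (L : ℝ) ^ 4 * F := by nlinarith [pow_nonneg hL0 4]

/-- ★★★ **The seam field versus the central projection, per site**: on the central region (slice `0` in comb gauge, `σ₄·Re q(P.2 0) ≥ ½`),
`‖q(P.2 x) − q((π_C P).2 x)‖² ≤ 5184·L⁴·F₀(P)`. [cite: CosteEtAl1985] -/
theorem norm_sq_seam_sub_centralProj_le (P : (Fin (2 * L - 1 + 1) → GaugeConfig 3 L SU2) × (Site 3 L → SU2))
    (ht : treeGauge (P.1 0) = 1) (σ : Fin 3 → ℝ) {σ₄ : ℝ} (hσ₄ : σ₄ = 1 ∨ σ₄ = -1)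
    (hS : (1 / 2 : ℝ) ≤ σ₄ * (su2Quat (P.2 0)).re) (x : Site 3 L) :
    ‖su2Quat (P.2 x) - su2Quat ((centralProj L σ σ₄ P).2 x)‖ ^ 2 ≤ 5184 * (L : ℝ) ^ 4 * ringDeficit L (fun _ => false) P := by
  set F := ringDeficit L (fun _ => false) P with hF
  set δ := Real.sqrt F with hδ
  have hF0 : 0 ≤ F := ringDeficit_nonneg _ P
  have hδ2 : δ ^ 2 = F := Real.sq_sqrt hF0
  have h2ab : ∀ a b : ℝ, (a + b) ^ 2 ≤ 2 * a ^ 2 + 2 * b ^ 2 := fun a b => by nlinarith [sq_nonneg (a - b)]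
  have hq1 : ‖su2Quat (P.2 x) - su2Quat (P.2 0)‖ ≤ 12 * (L : ℝ) ^ 2 * δ :=
    (norm_su2Quat_sub_le_fd _ _).trans (fd_seam_combShadow_le P ht x)
  show ‖su2Quat (P.2 x) - su2Quat (centralRep σ₄ (seamIm L P))‖ ^ 2 ≤ 5184 * (L : ℝ) ^ 4 * F
  have hz := normSq_seamIm_le_one P
  rw [su2Quat_centralRep (sq_eq_one_of_sign hσ₄) hz]
  have hb := norm_sq_seam_sub_lift_seamIm_le P ht hσ₄ hS
  have ha : ‖su2Quat (P.2 x) - su2Quat (P.2 0)‖ ^ 2 ≤ (12 * (L : ℝ) ^ 2 * δ) ^ 2 := pow_le_pow_left₀ (norm_nonneg _) hq1 2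
  have htri := norm_sub_le_norm_sub_add_norm_sub (su2Quat (P.2 x)) (su2Quat (P.2 0)) (liftQuat σ₄ (seamIm L P))
  calc ‖su2Quat (P.2 x) - liftQuat σ₄ (seamIm L P)‖ ^ 2
      ≤ (‖su2Quat (P.2 x) - su2Quat (P.2 0)‖ + ‖su2Quat (P.2 0) - liftQuat σ₄ (seamIm L P)‖) ^ 2 :=
        pow_le_pow_left₀ (norm_nonneg _) htri 2
    _ ≤ 2 * ‖su2Quat (P.2 x) - su2Quat (P.2 0)‖ ^ 2 + 2 * ‖su2Quat (P.2 0) - liftQuat σ₄ (seamIm L P)‖ ^ 2 := h2ab _ _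
    _ ≤ 2 * (12 * (L : ℝ) ^ 2 * δ) ^ 2 + 2 * (17 * (12 * (L : ℝ) ^ 2 * δ) ^ 2) := by linarith
    _ = 5184 * (L : ℝ) ^ 4 * δ ^ 2 := by ring
    _ = 5184 * (L : ℝ) ^ 4 * F := by rw [hδ2]

/-- ★★★ **TRANSVERSE CENTRAL COERCIVITY (polynomial form, exponent ONE)**: on the central region,
`Σ_{i,e} ‖q(P.1 i e) − q((π_C P).1 i e)‖² + Σ_x ‖q(P.2 x) − q((π_C P).2 x)‖² ≤ 60480·L⁸·F₀(P)` — the ring history is within `√(60480)·L⁴·√F₀(P)` of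
its central projection in the product (quaternion) metric, with NO additive zero-mode term. [cite: CosteEtAl1985] -/
theorem sum_norm_sq_sub_centralProj_le (P : (Fin (2 * L - 1 + 1) → GaugeConfig 3 L SU2) × (Site 3 L → SU2))
    (ht : treeGauge (P.1 0) = 1) {σ : Fin 3 → ℝ} (hσ : ∀ k, σ k = 1 ∨ σ k = -1) {σ₄ : ℝ} (hσ₄ : σ₄ = 1 ∨ σ₄ = -1)
    (hW : ∀ k : Fin 3, (1 / 2 : ℝ) ≤ σ k * (su2Quat (wrapReps (P.1 0) k)).re) (hS : (1 / 2 : ℝ) ≤ σ₄ * (su2Quat (P.2 0)).re) :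
    (∑ i : Fin (2 * L - 1 + 1), ∑ e : Edge 3 L, ‖su2Quat (P.1 i e) - su2Quat ((centralProj L σ σ₄ P).1 i e)‖ ^ 2) +
        ∑ x : Site 3 L, ‖su2Quat (P.2 x) - su2Quat ((centralProj L σ σ₄ P).2 x)‖ ^ 2 ≤
      60480 * (L : ℝ) ^ 8 * ringDeficit L (fun _ => false) P := by
  set F := ringDeficit L (fun _ => false) P with hF
  have hF0 : 0 ≤ F := ringDeficit_nonneg _ P
  have hL1 : (1 : ℝ) ≤ L := by exact_mod_cast NeZero.one_le
  have hL0 : (0 : ℝ) ≤ L := by linarith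
  have hcardI : (Fintype.card (Fin (2 * L - 1 + 1)) : ℝ) = 2 * (L : ℝ) := by
    rw [Fintype.card_fin]
    have hL : 1 ≤ L := NeZero.one_le
    rw [show 2 * L - 1 + 1 = 2 * L by omega]; push_cast; ring
  have hcardS : (Fintype.card (Site 3 L) : ℝ) = (L : ℝ) ^ 3 := by
    rw [Fintype.card_pi, Finset.prod_const, Finset.card_univ, Fintype.card_fin, ZMod.card]; push_cast; ring
  have hA : (∑ i : Fin (2 * L - 1 + 1), ∑ e : Edge 3 L, ‖su2Quat (P.1 i e) - su2Quat ((centralProj L σ σ₄ P).1 i e)‖ ^ 2) ≤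
      2 * (L : ℝ) * (3 * (L : ℝ) ^ 3 * (9216 * (L : ℝ) ^ 4 * F)) := by
    have hin : ∀ i : Fin (2 * L - 1 + 1), ∑ e : Edge 3 L, ‖su2Quat (P.1 i e) - su2Quat ((centralProj L σ σ₄ P).1 i e)‖ ^ 2 ≤
        3 * (L : ℝ) ^ 3 * (9216 * (L : ℝ) ^ 4 * F) := fun i =>
      calc ∑ e : Edge 3 L, ‖su2Quat (P.1 i e) - su2Quat ((centralProj L σ σ₄ P).1 i e)‖ ^ 2
          ≤ ∑ _e : Edge 3 L, 9216 * (L : ℝ) ^ 4 * F := Finset.sum_le_sum fun e _ => norm_sq_slice_sub_centralProj_le P ht hσ σ₄ hW i e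
        _ = 3 * (L : ℝ) ^ 3 * (9216 * (L : ℝ) ^ 4 * F) := by
            rw [Finset.sum_const, Finset.card_univ, nsmul_eq_mul, ConstTube.card_edge_three L]
    calc (∑ i : Fin (2 * L - 1 + 1), ∑ e : Edge 3 L, ‖su2Quat (P.1 i e) - su2Quat ((centralProj L σ σ₄ P).1 i e)‖ ^ 2)
        ≤ ∑ _i : Fin (2 * L - 1 + 1), 3 * (L : ℝ) ^ 3 * (9216 * (L : ℝ) ^ 4 * F) := Finset.sum_le_sum fun i _ => hin i
      _ = 2 * (L : ℝ) * (3 * (L : ℝ) ^ 3 * (9216 * (L : ℝ) ^ 4 * F)) := by rw [Finset.sum_const, Finset.card_univ, nsmul_eq_mul, hcardI]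
  have hB : ∑ x : Site 3 L, ‖su2Quat (P.2 x) - su2Quat ((centralProj L σ σ₄ P).2 x)‖ ^ 2 ≤ (L : ℝ) ^ 3 * (5184 * (L : ℝ) ^ 4 * F) := by
    calc ∑ x : Site 3 L, ‖su2Quat (P.2 x) - su2Quat ((centralProj L σ σ₄ P).2 x)‖ ^ 2
        ≤ ∑ _x : Site 3 L, 5184 * (L : ℝ) ^ 4 * F := Finset.sum_le_sum fun x _ => norm_sq_seam_sub_centralProj_le P ht σ hσ₄ hS x
      _ = (L : ℝ) ^ 3 * (5184 * (L : ℝ) ^ 4 * F) := by rw [Finset.sum_const, Finset.card_univ, nsmul_eq_mul, hcardS]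
  have hL78 : (L : ℝ) ^ 7 ≤ (L : ℝ) ^ 8 := pow_le_pow_right₀ hL1 (by norm_num)
  calc (∑ i : Fin (2 * L - 1 + 1), ∑ e : Edge 3 L, ‖su2Quat (P.1 i e) - su2Quat ((centralProj L σ σ₄ P).1 i e)‖ ^ 2) +
        ∑ x : Site 3 L, ‖su2Quat (P.2 x) - su2Quat ((centralProj L σ σ₄ P).2 x)‖ ^ 2
      ≤ 2 * (L : ℝ) * (3 * (L : ℝ) ^ 3 * (9216 * (L : ℝ) ^ 4 * F)) + (L : ℝ) ^ 3 * (5184 * (L : ℝ) ^ 4 * F) := add_le_add hA hB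
    _ = (55296 * (L : ℝ) ^ 8 + 5184 * (L : ℝ) ^ 7) * F := by ring
    _ ≤ (55296 * (L : ℝ) ^ 8 + 5184 * (L : ℝ) ^ 8) * F := by
        refine mul_le_mul_of_nonneg_right ?_ hF0; linarith
    _ = 60480 * (L : ℝ) ^ 8 * F := by ring

/-! ## §4 The central projection costs at most a polynomial -/

/-- ★★★ **ZERO-MODE CENTRAL COERCIVITY (polynomial form)**: on the central region, `F₀(π_C P) ≤ 880000·L⁶·F₀(P)` — the commutator quartic of
the central lifts (✓`ringDeficit_combConst_eq_commutator_quartic`) is controlled by the near-commutation of the shadow data (`20L²δ`, `12L²δ`) and the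
`2`-Lipschitz commutator (lifts within `√17·16L²δ`, `√17·12L²δ` of the shadow data).  With ✓`ringDeficit_centralProj` the left side is the explicit quartic
`2L²Σ_{k<l}4|z_k × z_l|² + L²Σ_k 4|z_k × z₄|²` of the block averages. [cite: CosteEtAl1985] -/
theorem ringDeficit_centralProj_le_mul (P : (Fin (2 * L - 1 + 1) → GaugeConfig 3 L SU2) × (Site 3 L → SU2))
    (ht : treeGauge (P.1 0) = 1) {σ : Fin 3 → ℝ} (hσ : ∀ k, σ k = 1 ∨ σ k = -1) {σ₄ : ℝ} (hσ₄ : σ₄ = 1 ∨ σ₄ = -1)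
    (hW : ∀ k : Fin 3, (1 / 2 : ℝ) ≤ σ k * (su2Quat (wrapReps (P.1 0) k)).re) (hS : (1 / 2 : ℝ) ≤ σ₄ * (su2Quat (P.2 0)).re) :
    ringDeficit L (fun _ => false) (centralProj L σ σ₄ P) ≤ 880000 * (L : ℝ) ^ 6 * ringDeficit L (fun _ => false) P := by
  set F := ringDeficit L (fun _ => false) P with hF
  set δ := Real.sqrt F with hδ
  have hF0 : 0 ≤ F := ringDeficit_nonneg _ P
  have hδ2 : δ ^ 2 = F := Real.sq_sqrt hF0
  have hδ0 : 0 ≤ δ := Real.sqrt_nonneg _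
  have hL0 : (0 : ℝ) ≤ L := Nat.cast_nonneg _
  set w := wrapReps (P.1 0) with hw
  set c := P.2 0 with hc
  set h : Fin 3 → SU2 := fun k => centralRep (σ k) (blockIm L (wrapBlock L k) k P) with hh
  set c' : SU2 := centralRep σ₄ (seamIm L P) with hc'
  have hπ : centralProj L σ σ₄ P = ((fun _ : Fin (2 * L - 1 + 1) => combFlat (L := L) h, fun _ : Site 3 L => c') :
      (Fin (2 * L - 1 + 1) → GaugeConfig 3 L SU2) × (Site 3 L → SU2)) := rfl
  -- the lifts versus the shadow data
  have hqh : ∀ k, su2Quat (h k) = liftQuat (σ k) (blockIm L (wrapBlock L k) k P) := fun k =>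
    su2Quat_centralRep (sq_eq_one_of_sign (hσ k)) (normSq_blockIm_le_one (wrapBlock L k) k P)
  have hqc' : su2Quat c' = liftQuat σ₄ (seamIm L P) := su2Quat_centralRep (sq_eq_one_of_sign hσ₄) (normSq_seamIm_le_one P)
  have hρ : ∀ k, ‖su2Quat (w k) - su2Quat (h k)‖ ^ 2 ≤ 17 * (16 * (L : ℝ) ^ 2 * δ) ^ 2 := fun k => by
    rw [hqh]; exact norm_sq_wrapRep_sub_lift_blockIm_le P ht (hσ k) k (hW k)
  have hρ₄ : ‖su2Quat c - su2Quat c'‖ ^ 2 ≤ 17 * (12 * (L : ℝ) ^ 2 * δ) ^ 2 := by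
    rw [hqc']; exact norm_sq_seam_sub_lift_seamIm_le P ht hσ₄ hS
  -- near-commutation of the shadow data
  have hX : ∀ k l, ‖su2Quat (w k) * su2Quat (w l) - su2Quat (w l) * su2Quat (w k)‖ ≤ 20 * (L : ℝ) ^ 2 * δ := fun k l =>
    (norm_quat_comm_le_fd _ _).trans (fd_comm_wraps_le P k l)
  have hY : ∀ k, ‖su2Quat (w k) * su2Quat c - su2Quat c * su2Quat (w k)‖ ≤ 12 * (L : ℝ) ^ 2 * δ := fun k =>
    (norm_quat_comm_le_fd _ _).trans (fd_comm_wrap_seam_le P ht k)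
  -- the commutators of the lifts
  have h1 : ∀ a : SU2, ‖su2Quat a‖ = 1 := norm_su2Quat
  have hww : ∀ k l, ‖su2Quat (h k) * su2Quat (h l) - su2Quat (h l) * su2Quat (h k)‖ ^ 2 ≤ 105648 * (L : ℝ) ^ 4 * δ ^ 2 := by
    intro k l
    have hlip := norm_comm_sub_comm_le (h1 (h k)) (h1 (h l)) (h1 (w k)) (h1 (w l))
    have htri : ‖su2Quat (h k) * su2Quat (h l) - su2Quat (h l) * su2Quat (h k)‖ ≤
        ‖su2Quat (w k) * su2Quat (w l) - su2Quat (w l) * su2Quat (w k)‖ +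
          (2 * ‖su2Quat (h k) - su2Quat (w k)‖ + 2 * ‖su2Quat (h l) - su2Quat (w l)‖) := by
      have := norm_sub_le_norm_sub_add_norm_sub (su2Quat (h k) * su2Quat (h l) - su2Quat (h l) * su2Quat (h k))
        (su2Quat (w k) * su2Quat (w l) - su2Quat (w l) * su2Quat (w k)) 0
      rw [sub_zero, sub_zero] at this
      linarith
    have ha := hX k l
    have hbk : ‖su2Quat (h k) - su2Quat (w k)‖ ^ 2 ≤ 17 * (16 * (L : ℝ) ^ 2 * δ) ^ 2 := by rw [norm_sub_rev]; exact hρ k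
    have hbl : ‖su2Quat (h l) - su2Quat (w l)‖ ^ 2 ≤ 17 * (16 * (L : ℝ) ^ 2 * δ) ^ 2 := by rw [norm_sub_rev]; exact hρ l
    have h3 : ∀ p q r : ℝ, (p + (2 * q + 2 * r)) ^ 2 ≤ 3 * p ^ 2 + 12 * q ^ 2 + 12 * r ^ 2 := fun p q r => by
      nlinarith [sq_nonneg (p - 2 * q), sq_nonneg (p - 2 * r), sq_nonneg (q - r)]
    have hX0 : 0 ≤ ‖su2Quat (w k) * su2Quat (w l) - su2Quat (w l) * su2Quat (w k)‖ := norm_nonneg _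
    calc ‖su2Quat (h k) * su2Quat (h l) - su2Quat (h l) * su2Quat (h k)‖ ^ 2
        ≤ (‖su2Quat (w k) * su2Quat (w l) - su2Quat (w l) * su2Quat (w k)‖ +
            (2 * ‖su2Quat (h k) - su2Quat (w k)‖ + 2 * ‖su2Quat (h l) - su2Quat (w l)‖)) ^ 2 :=
          pow_le_pow_left₀ (norm_nonneg _) htri 2
      _ ≤ 3 * ‖su2Quat (w k) * su2Quat (w l) - su2Quat (w l) * su2Quat (w k)‖ ^ 2 +
            12 * ‖su2Quat (h k) - su2Quat (w k)‖ ^ 2 + 12 * ‖su2Quat (h l) - su2Quat (w l)‖ ^ 2 := h3 _ _ _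
      _ ≤ 3 * (20 * (L : ℝ) ^ 2 * δ) ^ 2 + 12 * (17 * (16 * (L : ℝ) ^ 2 * δ) ^ 2) + 12 * (17 * (16 * (L : ℝ) ^ 2 * δ) ^ 2) := by
          nlinarith [pow_le_pow_left₀ hX0 ha 2]
      _ = 105648 * (L : ℝ) ^ 4 * δ ^ 2 := by ring
  have hws : ∀ k, ‖su2Quat (h k) * su2Quat c' - su2Quat c' * su2Quat (h k)‖ ^ 2 ≤ 82032 * (L : ℝ) ^ 4 * δ ^ 2 := by
    intro k
    have hlip := norm_comm_sub_comm_le (h1 (h k)) (h1 c') (h1 (w k)) (h1 c)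
    have htri : ‖su2Quat (h k) * su2Quat c' - su2Quat c' * su2Quat (h k)‖ ≤
        ‖su2Quat (w k) * su2Quat c - su2Quat c * su2Quat (w k)‖ +
          (2 * ‖su2Quat (h k) - su2Quat (w k)‖ + 2 * ‖su2Quat c' - su2Quat c‖) := by
      have := norm_sub_le_norm_sub_add_norm_sub (su2Quat (h k) * su2Quat c' - su2Quat c' * su2Quat (h k))
        (su2Quat (w k) * su2Quat c - su2Quat c * su2Quat (w k)) 0
      rw [sub_zero, sub_zero] at this
      linarith
    have ha := hY k
    have hbk : ‖su2Quat (h k) - su2Quat (w k)‖ ^ 2 ≤ 17 * (16 * (L : ℝ) ^ 2 * δ) ^ 2 := by rw [norm_sub_rev]; exact hρ k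
    have hb4 : ‖su2Quat c' - su2Quat c‖ ^ 2 ≤ 17 * (12 * (L : ℝ) ^ 2 * δ) ^ 2 := by rw [norm_sub_rev]; exact hρ₄
    have h3 : ∀ p q r : ℝ, (p + (2 * q + 2 * r)) ^ 2 ≤ 3 * p ^ 2 + 12 * q ^ 2 + 12 * r ^ 2 := fun p q r => by
      nlinarith [sq_nonneg (p - 2 * q), sq_nonneg (p - 2 * r), sq_nonneg (q - r)]
    have hY0 : 0 ≤ ‖su2Quat (w k) * su2Quat c - su2Quat c * su2Quat (w k)‖ := norm_nonneg _
    calc ‖su2Quat (h k) * su2Quat c' - su2Quat c' * su2Quat (h k)‖ ^ 2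
        ≤ (‖su2Quat (w k) * su2Quat c - su2Quat c * su2Quat (w k)‖ +
            (2 * ‖su2Quat (h k) - su2Quat (w k)‖ + 2 * ‖su2Quat c' - su2Quat c‖)) ^ 2 :=
          pow_le_pow_left₀ (norm_nonneg _) htri 2
      _ ≤ 3 * ‖su2Quat (w k) * su2Quat c - su2Quat c * su2Quat (w k)‖ ^ 2 +
            12 * ‖su2Quat (h k) - su2Quat (w k)‖ ^ 2 + 12 * ‖su2Quat c' - su2Quat c‖ ^ 2 := h3 _ _ _
      _ ≤ 3 * (12 * (L : ℝ) ^ 2 * δ) ^ 2 + 12 * (17 * (16 * (L : ℝ) ^ 2 * δ) ^ 2) + 12 * (17 * (12 * (L : ℝ) ^ 2 * δ) ^ 2) := by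
          nlinarith [pow_le_pow_left₀ hY0 ha 2]
      _ = 82032 * (L : ℝ) ^ 4 * δ ^ 2 := by ring
  -- sum
  have hcard : (Finset.univ : Finset {p : Fin 3 × Fin 3 // p.1 < p.2}).card = 3 := by decide
  have hs1 : ∑ p : {p : Fin 3 × Fin 3 // p.1 < p.2},
      ‖su2Quat (h p.1.1) * su2Quat (h p.1.2) - su2Quat (h p.1.2) * su2Quat (h p.1.1)‖ ^ 2 ≤ 3 * (105648 * (L : ℝ) ^ 4 * δ ^ 2) := by
    calc ∑ p : {p : Fin 3 × Fin 3 // p.1 < p.2}, ‖su2Quat (h p.1.1) * su2Quat (h p.1.2) - su2Quat (h p.1.2) * su2Quat (h p.1.1)‖ ^ 2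
        ≤ ∑ _p : {p : Fin 3 × Fin 3 // p.1 < p.2}, 105648 * (L : ℝ) ^ 4 * δ ^ 2 := Finset.sum_le_sum fun p _ => hww p.1.1 p.1.2
      _ = 3 * (105648 * (L : ℝ) ^ 4 * δ ^ 2) := by rw [Finset.sum_const, hcard, nsmul_eq_mul]; norm_num
  have hs2 : ∑ k : Fin 3, ‖su2Quat (h k) * su2Quat c' - su2Quat c' * su2Quat (h k)‖ ^ 2 ≤ 3 * (82032 * (L : ℝ) ^ 4 * δ ^ 2) := by
    calc ∑ k : Fin 3, ‖su2Quat (h k) * su2Quat c' - su2Quat c' * su2Quat (h k)‖ ^ 2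
        ≤ ∑ _k : Fin 3, 82032 * (L : ℝ) ^ 4 * δ ^ 2 := Finset.sum_le_sum fun k _ => hws k
      _ = 3 * (82032 * (L : ℝ) ^ 4 * δ ^ 2) := by rw [Finset.sum_const, Finset.card_univ, Fintype.card_fin, nsmul_eq_mul]; norm_num
  rw [hπ, ringDeficit_combConst_eq_commutator_quartic]
  have h2 : 0 ≤ 2 * (L : ℝ) ^ 2 := by positivity
  have h1' : 0 ≤ (L : ℝ) ^ 2 := by positivity
  calc 2 * (L : ℝ) ^ 2 * ∑ p : {p : Fin 3 × Fin 3 // p.1 < p.2},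
          ‖su2Quat (h p.1.1) * su2Quat (h p.1.2) - su2Quat (h p.1.2) * su2Quat (h p.1.1)‖ ^ 2 +
        (L : ℝ) ^ 2 * ∑ k : Fin 3, ‖su2Quat (h k) * su2Quat c' - su2Quat c' * su2Quat (h k)‖ ^ 2
      ≤ 2 * (L : ℝ) ^ 2 * (3 * (105648 * (L : ℝ) ^ 4 * δ ^ 2)) + (L : ℝ) ^ 2 * (3 * (82032 * (L : ℝ) ^ 4 * δ ^ 2)) :=
        add_le_add (mul_le_mul_of_nonneg_left hs1 h2) (mul_le_mul_of_nonneg_left hs2 h1')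
    _ = 879984 * (L : ℝ) ^ 6 * δ ^ 2 := by ring
    _ ≤ 880000 * (L : ℝ) ^ 6 * δ ^ 2 := by nlinarith [pow_nonneg hL0 6, sq_nonneg δ, mul_nonneg (pow_nonneg hL0 6) (sq_nonneg δ)]
    _ = 880000 * (L : ℝ) ^ 6 * F := by rw [hδ2]

end Summit.QuantumFields.YangMills.Theorems.VirialFluxGap.CentralCoercivity

end
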